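import Literature.Probability.Percolation.KozmaNitzanPreFKG

/-!
# Kozma–Nitzan's Theorem 1 with a PAIR observer: the pre-FKG inequality (3) for `|A| = 2` conditioned on `{0 ↔ c}`

Kozma–Nitzan (arXiv:2401.12397, Thm. 1, pp. 7–8) prove the pre-FKG inequality (3),
`P(0 ↔ b, 0 ↔ A) ≥ min_{a ∈ A} P(0 ↔ A, a ↔ b)`, for `A = {a₁, a₂}` by "applying BHK four times" given
`{a₁ ↮ a₂}`.  The only property of the observer events `{0 ↔ a_j}` used in that proof is that
`1{0 ∈ C(a_j)}` is an INCREASING function of the cluster of `a_j`.  Replacing the observer vertex `0` by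
the PAIR `{0, c}` — observer events `{0 ↔ a_j} ∩ {c ↔ a_j} = {0, c ∈ C(a_j)}`, still increasing in
`C(a_j)` — the proof goes through verbatim and yields (3) CONDITIONED on the increasing connection
`{0 ↔ c}`:
`P(0 ↔ c, 0 ↔ b, 0 ↔ A) ≥ min_{a ∈ A} P(0 ↔ c, 0 ↔ A, a ↔ b)` for `|A| = 2`,
equivalently `μ(0 ↔ c, 0 ↔ A, 0 ↮ b) ≤ max_{a ∈ A} μ(0 ↔ c, 0 ↔ A, a ↮ b)` (row M1-C2 of the prim-rate
constants-miner, `|A| = 2` case), and by Harris the conditioned event gluing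
`μ(0 ↔ c, 0 ↔ A, 0 ↮ b) ≤ max_a μ(a ↮ b) · μ(0 ↔ c, 0 ↔ A)` (row M1-C1, `|A| = 2`).
The general-`|A|` statements are CONJECTURES (census-clean on all graphs with ≤ 6 vertices and under
adversarial search to 10 vertices; `run/shared/lean/prim/prim-rate/prim-rate-mine-1/CANDIDATES.md`); the
analogous statement conditioned on a connection NOT through the observer (`{a ↔ a'}`, `{a ↔ s}`) is FALSE.

## Main statements
* `PairObserver.preFKG_pair_pairObserver` — the min-form above (clone of `KNPreFKG.preFKG_pair`).
* `PairObserver.condPreFKGGluing_pair` — the max/complement form (M1-C2 at `|A| = 2`).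
* `PairObserver.condEventGluing_pair` — the product form with `s ≥ μ(a_i ↮ b)` (M1-C1 at `|A| = 2`), by Harris.

## References
* [KozmaNitzan2024] G. Kozma, S. Nitzan, arXiv:2401.12397, Thm. 1 (pp. 7–8), display (3) (p. 3).
* [VandenbergHaggstromKahn2005] J. van den Berg, O. Häggström, J. Kahn, Random Struct. Alg. 29 (2006),
  Thms. 1.3–1.5 (the BHK inequalities, tree `KNPreFKG.bhk_*`).
-/

noncomputable section

open MeasureTheory Set
open Literature.Probability.LatticeModels (prodBernoulli)
open Literature.Probability.Percolation
open Literature.Probability.Percolation.KNPreFKG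

namespace Summit.CriticalPhenomena.PercolationContinuityZ3.Theorems.PairObserver

variable {V : Type*} [Fintype V]

omit [Fintype V] in
/-- The pair-observer event `{o ↔ a} ∩ {c ↔ a}` (both `o` and `c` lie in the cluster of `a`) is the event
that the open edge cluster of `a` lies in the upper family `connFamily a o ∩ connFamily a c`. [folklore] -/
theorem pairObs_eq_setOf (a o c : V) :
    (openConn o a ∩ openConn c a : Set (BondConfig V)) =
      {ω | openEdgeCluster ω a ∈ connFamily a o ∩ connFamily a c} := by
  rw [openConn_symm o a, openConn_symm c a, openConn_eq_setOf_connFamily, openConn_eq_setOf_connFamily]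
  rfl

/-- **Kozma–Nitzan's Theorem 1 with the pair observer `{o, c}`.**  With
`O_j = {o ↔ a_j} ∩ {c ↔ a_j}` and `E = O₁ ∪ O₂ = {o ↔ c} ∩ {o ↔ A}` (`A = {a₁, a₂}`):
`min(μ(E ∩ {a₁ ↔ b}), μ(E ∩ {a₂ ↔ b})) ≤ μ({o ↔ b} ∩ E)`.  Proof: the printed proof of Theorem 1
("BHK four times" given `{a₁ ↮ a₂}`), with the increasing cluster events `{o ∈ C(a_j)}` replaced by the
increasing cluster events `{o, c ∈ C(a_j)}`. [cite: KozmaNitzan2024, Thm. 1 (pp. 7–8)] -/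
theorem preFKG_pair_pairObserver (w : Sym2 V → unitInterval) (o c b a₁ a₂ : V) :
    min ((prodBernoulli w).real (((openConn o a₁ ∩ openConn c a₁) ∪ (openConn o a₂ ∩ openConn c a₂)) ∩
            openConn a₁ b))
        ((prodBernoulli w).real (((openConn o a₁ ∩ openConn c a₁) ∪ (openConn o a₂ ∩ openConn c a₂)) ∩
            openConn a₂ b)) ≤
      (prodBernoulli w).real (openConn o b ∩
        ((openConn o a₁ ∩ openConn c a₁) ∪ (openConn o a₂ ∩ openConn c a₂) : Set (BondConfig V))) := by
  classical
  by_cases h12 : a₁ = a₂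
  · subst h12
    rw [union_self]
    refine (min_le_left _ _).trans (measureReal_mono ?_)
    rintro ω ⟨⟨hA, hc⟩, hb⟩
    exact ⟨SimpleGraph.Reachable.trans hA hb, hA, hc⟩
  set μ := prodBernoulli w with hμ
  set O₁ : Set (BondConfig V) := openConn o a₁ ∩ openConn c a₁ with hO₁
  set O₂ : Set (BondConfig V) := openConn o a₂ ∩ openConn c a₂ with hO₂
  set Ob : Set (BondConfig V) := openConn o b with hOb
  set B₁ : Set (BondConfig V) := openConn a₁ b with hB₁
  set B₂ : Set (BondConfig V) := openConn a₂ b with hB₂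
  set D : Set (BondConfig V) := {ω | ¬ (openGraph ω).Reachable a₁ a₂} with hD
  set E : Set (BondConfig V) := Ob ∩ (O₁ ∪ O₂) with hE
  set F₁ : Set (BondConfig V) := (O₁ ∪ O₂) ∩ B₁ with hF₁
  set F₂ : Set (BondConfig V) := (O₁ ∪ O₂) ∩ B₂ with hF₂
  have hsplit : ∀ A S : Set (BondConfig V), μ.real A = μ.real (A ∩ S) + μ.real (A ∩ Sᶜ) := by
    intro A S
    rw [← measureReal_inter_add_sdiff (s := A) (MeasurableSet.of_discrete : MeasurableSet S), Set.sdiff_eq]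
  -- the two "subtract the common event" identities
  have hE1 : E ∩ O₁ = F₁ ∩ O₁ := by
    ext ω
    simp only [mem_inter_iff, mem_union, hE, hF₁, hO₁, hO₂, hOb, hB₁, openConn, mem_setOf_eq]
    constructor
    · rintro ⟨⟨hb, _⟩, h1, hc1⟩
      exact ⟨⟨Or.inl ⟨h1, hc1⟩, h1.symm.trans hb⟩, h1, hc1⟩
    · rintro ⟨⟨_, hb⟩, h1, hc1⟩
      exact ⟨⟨h1.trans hb, Or.inl ⟨h1, hc1⟩⟩, h1, hc1⟩
  have hE1c : E ∩ O₁ᶜ = O₂ ∩ B₂ ∩ D := by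
    ext ω
    simp only [mem_inter_iff, mem_union, mem_compl_iff, hE, hO₁, hO₂, hOb, hB₂, hD, openConn,
      mem_setOf_eq, not_and]
    constructor
    · rintro ⟨⟨hb, h1 | h2⟩, hn1⟩
      · exact absurd h1.2 (hn1 h1.1)
      · exact ⟨⟨h2, h2.1.symm.trans hb⟩, fun h => hn1 (h2.1.trans h.symm) (h2.2.trans h.symm)⟩
    · rintro ⟨⟨h2, hb⟩, hn⟩
      exact ⟨⟨h2.1.trans hb, Or.inr h2⟩, fun h1 _ => hn (h1.symm.trans h2.1)⟩
  have hF1c : F₁ ∩ O₁ᶜ = O₂ ∩ B₁ ∩ D := by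
    ext ω
    simp only [mem_inter_iff, mem_union, mem_compl_iff, hF₁, hO₁, hO₂, hB₁, hD, openConn,
      mem_setOf_eq, not_and]
    constructor
    · rintro ⟨⟨h1 | h2, hb⟩, hn1⟩
      · exact absurd h1.2 (hn1 h1.1)
      · exact ⟨⟨h2, hb⟩, fun h => hn1 (h2.1.trans h.symm) (h2.2.trans h.symm)⟩
    · rintro ⟨⟨h2, hb⟩, hn⟩
      exact ⟨⟨Or.inr h2, hb⟩, fun h1 _ => hn (h1.symm.trans h2.1)⟩
  have hE2 : E ∩ O₂ = F₂ ∩ O₂ := by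
    ext ω
    simp only [mem_inter_iff, mem_union, hE, hF₂, hO₁, hO₂, hOb, hB₂, openConn, mem_setOf_eq]
    constructor
    · rintro ⟨⟨hb, _⟩, h2, hc2⟩
      exact ⟨⟨Or.inr ⟨h2, hc2⟩, h2.symm.trans hb⟩, h2, hc2⟩
    · rintro ⟨⟨_, hb⟩, h2, hc2⟩
      exact ⟨⟨h2.trans hb, Or.inr ⟨h2, hc2⟩⟩, h2, hc2⟩
  have hE2c : E ∩ O₂ᶜ = O₁ ∩ B₁ ∩ D := by
    ext ω
    simp only [mem_inter_iff, mem_union, mem_compl_iff, hE, hO₁, hO₂, hOb, hB₁, hD, openConn,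
      mem_setOf_eq, not_and]
    constructor
    · rintro ⟨⟨hb, h1 | h2⟩, hn2⟩
      · exact ⟨⟨h1, h1.1.symm.trans hb⟩, fun h => hn2 (h1.1.trans h) (h1.2.trans h)⟩
      · exact absurd h2.2 (hn2 h2.1)
    · rintro ⟨⟨h1, hb⟩, hn⟩
      exact ⟨⟨h1.1.trans hb, Or.inl h1⟩, fun h2 _ => hn (h1.1.symm.trans h2)⟩
  have hF2c : F₂ ∩ O₂ᶜ = O₁ ∩ B₂ ∩ D := by
    ext ω
    simp only [mem_inter_iff, mem_union, mem_compl_iff, hF₂, hO₁, hO₂, hB₂, hD, openConn,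
      mem_setOf_eq, not_and]
    constructor
    · rintro ⟨⟨h1 | h2, hb⟩, hn2⟩
      · exact ⟨⟨h1, hb⟩, fun h => hn2 (h1.1.trans h) (h1.2.trans h)⟩
      · exact absurd h2.2 (hn2 h2.1)
    · rintro ⟨⟨h1, hb⟩, hn⟩
      exact ⟨⟨Or.inl h1, hb⟩, fun h2 _ => hn (h1.1.symm.trans h2)⟩
  have hdiff1 : μ.real E - μ.real F₁ = μ.real (O₂ ∩ B₂ ∩ D) - μ.real (O₂ ∩ B₁ ∩ D) := by
    rw [hsplit E O₁, hsplit F₁ O₁, hE1, hE1c, hF1c]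
    ring
  have hdiff2 : μ.real E - μ.real F₂ = μ.real (O₁ ∩ B₁ ∩ D) - μ.real (O₁ ∩ B₂ ∩ D) := by
    rw [hsplit E O₂, hsplit F₂ O₂, hE2, hE2c, hF2c]
    ring
  -- "Applying BHK 4 times", given `D = {a₁ ↮ a₂}`, with the pair-observer upper families
  have hD1 : {ω : BondConfig V | ∀ x ∈ ({a₂} : Set V), ¬ (openGraph ω).Reachable a₁ x} = D := by
    ext ω
    simp [hD]
  have hD2 : {ω : BondConfig V | ∀ x ∈ ({a₁} : Set V), ¬ (openGraph ω).Reachable a₂ x} = D := by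
    ext ω
    simp only [mem_setOf_eq, mem_singleton_iff, forall_eq, hD]
    exact not_congr ⟨SimpleGraph.Reachable.symm, SimpleGraph.Reachable.symm⟩
  have hD3 : {ω : BondConfig V | ¬ (openGraph ω).Reachable a₂ a₁} = D := by
    ext ω
    simp only [mem_setOf_eq, hD]
    exact not_congr ⟨SimpleGraph.Reachable.symm, SimpleGraph.Reachable.symm⟩
  have hU₁ : IsUpperSet (connFamily a₁ o ∩ connFamily a₁ c) :=
    (isUpperSet_connFamily a₁ o).inter (isUpperSet_connFamily a₁ c)
  have hU₂ : IsUpperSet (connFamily a₂ o ∩ connFamily a₂ c) :=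
    (isUpperSet_connFamily a₂ o).inter (isUpperSet_connFamily a₂ c)
  -- (i) `μ(D, O₂) μ(D, a₂↔b) ≤ μ(D) μ(D, O₂, a₂↔b)` (Thm. 1.3 in `C_{a₂}`)
  have h_i := bhk_one_upper_upper w a₂ ({a₁} : Set V) (by simpa using Ne.symm h12)
    hU₂ (isUpperSet_connFamily a₂ b)
  rw [hD2, ← pairObs_eq_setOf, ← openConn_eq_setOf_connFamily] at h_i
  -- (ii) `μ(D) μ(D, O₂, a₁↔b) ≤ μ(D, O₂) μ(D, a₁↔b)` (Thm. 1.4, `C_{a₂}` and `C_{a₁}`)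
  have h_ii := bhk_two_upper_upper w a₂ a₁ (Ne.symm h12) hU₂ (isUpperSet_connFamily a₁ b)
  rw [hD3, ← pairObs_eq_setOf, ← openConn_eq_setOf_connFamily] at h_ii
  -- (iii) `μ(D, O₁) μ(D, a₁↔b) ≤ μ(D) μ(D, O₁, a₁↔b)` (Thm. 1.3 in `C_{a₁}`)
  have h_iii := bhk_one_upper_upper w a₁ ({a₂} : Set V) (by simpa using h12)
    hU₁ (isUpperSet_connFamily a₁ b)
  rw [hD1, ← pairObs_eq_setOf, ← openConn_eq_setOf_connFamily] at h_iii
  -- (iv) `μ(D) μ(D, O₁, a₂↔b) ≤ μ(D, O₁) μ(D, a₂↔b)` (Thm. 1.4, `C_{a₁}` and `C_{a₂}`)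
  have h_iv := bhk_two_upper_upper w a₁ a₂ h12 hU₁ (isUpperSet_connFamily a₂ b)
  rw [← pairObs_eq_setOf, ← openConn_eq_setOf_connFamily] at h_iv
  -- normalise the intersections
  have e1 : D ∩ (O₂ ∩ B₂) = O₂ ∩ B₂ ∩ D := inter_comm _ _
  have e2 : D ∩ (O₂ ∩ B₁) = O₂ ∩ B₁ ∩ D := inter_comm _ _
  have e3 : D ∩ (O₁ ∩ B₁) = O₁ ∩ B₁ ∩ D := inter_comm _ _
  have e4 : D ∩ (O₁ ∩ B₂) = O₁ ∩ B₂ ∩ D := inter_comm _ _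
  simp only [← hD, ← hO₁, ← hO₂, ← hB₁, ← hB₂] at h_i h_ii h_iii h_iv
  rw [e1] at h_i
  rw [e2] at h_ii
  rw [e3] at h_iii
  rw [e4] at h_iv
  -- combine
  by_cases hD0 : μ.real D = 0
  · have hz : ∀ A : Set (BondConfig V), μ.real (A ∩ D) = 0 := fun A =>
      le_antisymm ((measureReal_mono inter_subset_right).trans hD0.le) measureReal_nonneg
    have : μ.real E = μ.real F₁ := by
      have := hdiff1
      rw [hz, hz, sub_self, sub_eq_zero] at this
      exact this
    exact (min_le_left _ _).trans this.symm.le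
  · have hDpos : 0 < μ.real D := lt_of_le_of_ne measureReal_nonneg (Ne.symm hD0)
    rcases le_total (μ.real (D ∩ B₁)) (μ.real (D ∩ B₂)) with ht | ht
    · refine (min_le_left _ _).trans ?_
      have key : μ.real D * (μ.real E - μ.real F₁) ≥ 0 := by
        rw [hdiff1, mul_sub]
        have hs2 : 0 ≤ μ.real (D ∩ O₂) := measureReal_nonneg
        nlinarith [h_i, h_ii, mul_le_mul_of_nonneg_left ht hs2]
      nlinarith [key]
    · refine (min_le_right _ _).trans ?_
      have key : μ.real D * (μ.real E - μ.real F₂) ≥ 0 := by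
        rw [hdiff2, mul_sub]
        have hs1 : 0 ≤ μ.real (D ∩ O₁) := measureReal_nonneg
        nlinarith [h_iii, h_iv, mul_le_mul_of_nonneg_left ht hs1]
      nlinarith [key]

/-- **M1-C2 at `|A| = 2` (conditioned pre-FKG gluing, complement form).**  With `E = {o ↔ c} ∩ {o ↔ A}`,
`A = {a₁, a₂}`: if `μ(E ∩ {a_i ↮ b}) ≤ m` for `i = 1, 2` then `μ(E ∩ {o ↮ b}) ≤ m`.
[cite: KozmaNitzan2024, Thm. 1 (pp. 7–8), display (3) (p. 3)] -/
theorem condPreFKGGluing_pair (w : Sym2 V → unitInterval) (o c b a₁ a₂ : V) (m : ℝ)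
    (h₁ : (prodBernoulli w).real ((openConn o c ∩ (openConn o a₁ ∪ openConn o a₂)) ∩
        (openConn a₁ b : Set (BondConfig V))ᶜ) ≤ m)
    (h₂ : (prodBernoulli w).real ((openConn o c ∩ (openConn o a₁ ∪ openConn o a₂)) ∩
        (openConn a₂ b : Set (BondConfig V))ᶜ) ≤ m) :
    (prodBernoulli w).real ((openConn o c ∩ (openConn o a₁ ∪ openConn o a₂)) ∩
        (openConn o b : Set (BondConfig V))ᶜ) ≤ m := by
  classical
  set μ := prodBernoulli w with hμ
  -- `{o ↔ c} ∩ {o ↔ A}` is the pair-observer event `O₁ ∪ O₂`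
  have hEq : (openConn o c ∩ (openConn o a₁ ∪ openConn o a₂) : Set (BondConfig V)) =
      (openConn o a₁ ∩ openConn c a₁) ∪ (openConn o a₂ ∩ openConn c a₂) := by
    ext ω
    simp only [mem_inter_iff, mem_union, openConn, mem_setOf_eq]
    constructor
    · rintro ⟨hc, h1 | h2⟩
      · exact Or.inl ⟨h1, hc.symm.trans h1⟩
      · exact Or.inr ⟨h2, hc.symm.trans h2⟩
    · rintro (⟨h1, hc1⟩ | ⟨h2, hc2⟩)
      · exact ⟨h1.trans hc1.symm, Or.inl h1⟩
      · exact ⟨h2.trans hc2.symm, Or.inr h2⟩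
  have key := preFKG_pair_pairObserver w o c b a₁ a₂
  rw [← hEq] at key
  set G : Set (BondConfig V) := openConn o c ∩ (openConn o a₁ ∪ openConn o a₂) with hG
  have hsplit : ∀ S : Set (BondConfig V), μ.real G = μ.real (G ∩ S) + μ.real (G ∩ Sᶜ) := by
    intro S
    rw [← measureReal_inter_add_sdiff (s := G) (MeasurableSet.of_discrete : MeasurableSet S), Set.sdiff_eq]
  have c1 := hsplit (openConn a₁ b)
  have c2 := hsplit (openConn a₂ b)
  have c3 := hsplit (openConn o b)
  rw [inter_comm G (openConn o b)] at c3
  rcases min_choice (μ.real (G ∩ openConn a₁ b)) (μ.real (G ∩ openConn a₂ b)) with hmin | hmin <;>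
    rw [hmin] at key <;> linarith

/-- **M1-C1 at `|A| = 2` (conditioned event gluing, product form).**  With `E = {o ↔ c} ∩ {o ↔ A}`,
`A = {a₁, a₂}`: if `μ(a_i ↮ b) ≤ s` for `i = 1, 2` then `μ(E ∩ {o ↮ b}) ≤ s · μ(E)` — Kozma–Nitzan's
Conjecture 1 in event form survives conditioning on the increasing connection `{o ↔ c}` (for two relays).
From `condPreFKGGluing_pair` and Harris (`E` increasing, `{a_i ↮ b}` decreasing).
[cite: KozmaNitzan2024, Thm. 1 (pp. 7–8), Conj. 1 (p. 3)] -/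
theorem condEventGluing_pair (w : Sym2 V → unitInterval) (o c b a₁ a₂ : V) (s : ℝ)
    (h₁ : (prodBernoulli w).real (openConn a₁ b : Set (BondConfig V))ᶜ ≤ s)
    (h₂ : (prodBernoulli w).real (openConn a₂ b : Set (BondConfig V))ᶜ ≤ s) :
    (prodBernoulli w).real ((openConn o c ∩ (openConn o a₁ ∪ openConn o a₂)) ∩
        (openConn o b : Set (BondConfig V))ᶜ) ≤
      s * (prodBernoulli w).real (openConn o c ∩ (openConn o a₁ ∪ openConn o a₂) : Set (BondConfig V)) := by
  classical
  set μ := prodBernoulli w with hμ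
  set G : Set (BondConfig V) := openConn o c ∩ (openConn o a₁ ∪ openConn o a₂) with hG
  have hGup : IsUpperSet G :=
    (isUpperSet_openConn o c).inter ((isUpperSet_openConn o a₁).union (isUpperSet_openConn o a₂))
  have hmeas : ∀ S : Set (BondConfig V), MeasurableSet S := fun _ => MeasurableSet.of_discrete
  have hG0 : 0 ≤ μ.real G := measureReal_nonneg
  have harris : ∀ a : V, μ.real (G ∩ (openConn a b : Set (BondConfig V))ᶜ) ≤
      μ.real G * μ.real (openConn a b : Set (BondConfig V))ᶜ := fun a =>
    Literature.Probability.LatticeModels.prodBernoulli_harris_upper_lower w hGup (isUpperSet_openConn a b).compl (hmeas _) (hmeas _)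
  have hb1 : μ.real (G ∩ (openConn a₁ b : Set (BondConfig V))ᶜ) ≤ s * μ.real G := by
    calc μ.real (G ∩ (openConn a₁ b : Set (BondConfig V))ᶜ)
        ≤ μ.real G * μ.real (openConn a₁ b : Set (BondConfig V))ᶜ := harris a₁
      _ ≤ μ.real G * s := mul_le_mul_of_nonneg_left h₁ hG0
      _ = s * μ.real G := mul_comm _ _
  have hb2 : μ.real (G ∩ (openConn a₂ b : Set (BondConfig V))ᶜ) ≤ s * μ.real G := by
    calc μ.real (G ∩ (openConn a₂ b : Set (BondConfig V))ᶜ)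
        ≤ μ.real G * μ.real (openConn a₂ b : Set (BondConfig V))ᶜ := harris a₂
      _ ≤ μ.real G * s := mul_le_mul_of_nonneg_left h₂ hG0
      _ = s * μ.real G := mul_comm _ _
  exact condPreFKGGluing_pair w o c b a₁ a₂ (s * μ.real G) hb1 hb2

end Summit.CriticalPhenomena.PercolationContinuityZ3.Theorems.PairObserver

end
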